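import Literature.Analysis.DeBrangesSpaces.BurnolCoPoissonHLambda
import Literature.Analysis.DeBrangesSpaces.BurnolTestFunctionMellin
import Mathlib.Analysis.Analytic.Order
import HarnessLib

/-!
# Burnol 2001 (CRAS 333), Théorème 3.1: `W_Λ ⊂ H_Λ`, and `Z^Λ_{w,k} ⊥ W_Λ` iff `w` is a non-trivial zero
# `ρ` of `ζ` with `k < m_ρ` — DISCHARGE of `Burnol2001CRAS_thm3_1`

LINE 1 — LABEL: RH-FREE (a Hilbert-space dictionary between the multiset of non-trivial zeros of `ζ`,
WHEREVER they lie, and the evaluators of `H_Λ` perpendicular to the co-Poisson subspace `W_Λ`; an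
equivalence about each `(w,k)`, no location of any zero is asserted). FRAMING (cell rh-crit, D-0074):
corpus theorems are RH-FREE literature; nothing here is worded as progress toward RH. bears_on: B-C/B-P
(LADDER-RH COLUMN 6, de Branges framework). WHAT THIS IS NOT: not a route, not an RH criterion;
nothing here bears on the truth of RH.

Source: J.-F. Burnol, *Sur certains espaces de Hilbert de fonctions entières, liés à la transformation de
Fourier et aux fonctions L de Dirichlet et de Riemann*, C. R. Acad. Sci. Paris Sér. I **333** (2001)
201–206 = arXiv:math/0105120 [Burnol2001CRAS], §3, Théorème 3.1 (TeX of record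
`dbl/src/Burnol2001CRAS_arXivmath0105120.tex` l.522–540; = Theorem 3 of the English summary,
l.207–215): *Soit `Λ > 1`. On a `W_Λ ⊂ H_Λ`. Un vecteur `Z^Λ_{w,k}` est perpendiculaire à `W_Λ` si et
seulement si `w` est un zéro non-trivial `ρ` de la fonction dzêta de Riemann et `0 ≤ k < m_ρ`.* Typed in
`BurnolSonineSpaces.lean` as the named fact `Burnol2001.Burnol2001CRAS_thm3_1`.

Printed proof (TeX l.528–540), followed here: `E(φ) ∈ H_Λ` by co-Poisson (file
`BurnolCoPoissonHLambda.lean`, `crasW_subset_memHLambda`); "Sa transformée de Mellin complétée est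
`M(E(φ))(s) = ζ(s)s(s−1)π^{−s/2}Γ(s/2)ψ̂(s)`. L'assertion finale en découle puisque `ψ ∈ 𝒱_Λ` est
arbitraire" — i.e. `(E(φ), Z^Λ_{w,k}] = M(E(φ))^{(k)}(w)` for all `φ ∈ D(𝒱_Λ)` (definition of the
evaluator), the entire function `s(s−1)Λ(s)` (`Λ = π^{−s/2}Γ(s/2)ζ`) vanishes exactly at the
non-trivial zeros, to order `m_ρ`, and the jets of `ψ̂` at `w` are arbitrary (we use the test functions
`ψ = T_wⁿ θ`, `(T_wⁿθ)^ = (s−w)ⁿθ̂`, `θ̂(w) ≠ 0`, file `BurnolTestFunctionMellin.lean`).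

## What is PROVED (theorem-only module: no definition, no named fact)

* `exists_memDVLambda_mellin_eq` (`φ = T_1 T_0 T_wⁿ θ ∈ D(𝒱_Λ)` with `φ̂ = s(s−1)(s−w)ⁿθ̂`),
  `completedMellinE_eq_of_mellin_eq` — then `M(E(φ))(s) = (s(s−1)Λ₀(s) + 1)·(s−w)ⁿ·θ̂(s)` on all of `ℂ`
  (`s(s−1)Λ₀(s) + 1 = s(s−1)Λ(s) = 2ξ(s)`, `xiTwo_eq_of_ne`), and `analyticOrderAt_completedMellinE_eq` — its
  analytic order at `w` is `ord_w(2ξ) + n` when `θ̂(w) ≠ 0`.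
* `mem_nontrivialZeros_of_xiTwo_eq_zero`, `analyticOrderAt_xiTwo_eq`, `analyticOrderAt_completedRiemannZeta_eq`,
  `riemannZetaZeroOrder_eq_of_analyticOrderAt`, `analyticOrderAt_xiTwo_ne_top` — zeros of `s(s−1)Λ₀(s)+1`
  are non-trivial zeros of `ζ` (`Λ(−2n−2) = Λ(2n+3) ≠ 0`), with analytic order
  `ord_w(2ξ) = ord_w Λ = ord_w ζ = m_w = riemannZetaZeroOrder w` (`Γ_ℝ` analytic and non-zero there).
* `iteratedDeriv_completedMellinE_eq_zero` — (⟸) at a non-trivial zero `ρ` with `k < m_ρ`,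
  `M(E(φ))^{(k)}(ρ) = 0` for every `φ ∈ D(𝒱_Λ)`;
  `mem_nontrivialZeros_of_forall_iteratedDeriv_eq_zero` — (⟹) if `M(E(φ))^{(k)}(w) = 0` for all
  `φ ∈ D(𝒱_Λ)` (`Λ > 1`) then `w` is a non-trivial zero and `k < m_w`.
* `inner_eq_two_mul_iteratedDeriv` — `⟪E(φ), Z⟫ = 2·M(E(φ̄))^{(k)}(w)` for an evaluator `Z = Z^Λ_{w,k}`
  (`⟪·,·⟫` of `L²(ℝ)` on even classes is `2∫₀^∞ \bar{F} Z`; `IsEvaluatorZ`).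
* **`Burnol2001CRAS_thm3_1_holds : Burnol2001CRAS_thm3_1`.**

## References
* [Burnol2001CRAS] C. R. Acad. Sci. Paris Sér. I 333 (2001) 201–206, §3, Théorème 3.1 (TeX l.522–540).
* [Burnol2004] Forum Math. 16 (2004) 789–840, §4/§6 (co-Poisson) — via `BurnolCoPoissonHLambda.lean`.
* E. C. Titchmarsh, *The Theory of the Riemann Zeta-Function*, §2.11 (Müntz) — via
  `BurnolTestFunctionMellin.lean` [Titchmarsh1986].
-/

noncomputable section

open _root_.MeasureTheory _root_.Set _root_.Filter _root_.Complex
open scoped Topology ContDiff ComplexConjugate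
open Literature.NumberTheory.LFunctions

namespace Literature.Analysis.DeBrangesSpaces

namespace Burnol2001

section Xi

/-! ### The entire function `s(s−1)Λ₀(s) + 1 = s(s−1)Λ(s)` (`= 2ξ(s)`) -/

/-- `s(s−1)Λ₀(s) + 1 = s(s−1)Λ(s)` off `{0,1}` (`Λ(s) = Λ₀(s) − 1/s − 1/(1−s)`).
[cite: Burnol2001CRAS, §3 (TeX l.536–540)] -/
theorem xiTwo_eq_of_ne {s : ℂ} (hs0 : s ≠ 0) (hs1 : s ≠ 1) :
    s * (s - 1) * completedRiemannZeta₀ s + 1 = s * (s - 1) * completedRiemannZeta s := by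
  rw [completedRiemannZeta_eq]
  have hs1' : (1 : ℂ) - s ≠ 0 := sub_ne_zero.2 (Ne.symm hs1)
  field_simp
  ring

/-- `s ↦ s(s−1)Λ₀(s) + 1` is entire. [cite: Burnol2001CRAS, §3 (TeX l.536–540)] -/
theorem differentiable_xiTwo :
    Differentiable ℂ (fun s : ℂ ↦ s * (s - 1) * completedRiemannZeta₀ s + 1) :=
  (((differentiable_id.mul (differentiable_id.sub_const 1)).mul differentiable_completedZeta₀).add_const 1)

/-- `s(s−1)Λ₀(s) + 1` has finite analytic order at every point (it is entire and equals `1` at `s = 0`).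
[cite: Burnol2001CRAS, §3 (TeX l.536–540)] -/
theorem analyticOrderAt_xiTwo_ne_top (w : ℂ) :
    analyticOrderAt (fun s : ℂ ↦ s * (s - 1) * completedRiemannZeta₀ s + 1) w ≠ ⊤ := by
  intro htop
  have hev := analyticOrderAt_eq_top.1 htop
  have han : AnalyticOnNhd ℂ (fun s : ℂ ↦ s * (s - 1) * completedRiemannZeta₀ s + 1) univ :=
    fun z _ ↦ differentiable_xiTwo.analyticAt z
  have h0 := han.eqOn_zero_of_preconnected_of_eventuallyEq_zero isPreconnected_univ (mem_univ w) hev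
    (mem_univ (0 : ℂ))
  simp at h0

/-- `Λ(−2(n+1)) ≠ 0`: by the functional equation `Λ(−2n−2) = Λ(2n+3) = Γ_ℝ(2n+3)ζ(2n+3) ≠ 0` — the
"trivial zeros" of `ζ` are not zeros of the completed zeta function. [folklore] -/
private theorem completedRiemannZeta_neg_two_mul_ne_zero (n : ℕ) :
    completedRiemannZeta (-2 * ((n : ℂ) + 1)) ≠ 0 := by
  have hfe : completedRiemannZeta (-2 * ((n : ℂ) + 1)) = completedRiemannZeta (2 * n + 3) := by
    rw [← completedRiemannZeta_one_sub (2 * n + 3)]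
    congr 1
    ring
  rw [hfe]
  have hre : (1 : ℝ) < (2 * (n : ℂ) + 3).re := by
    simp
    linarith [show (0 : ℝ) ≤ n from Nat.cast_nonneg n]
  have hne0 : (2 * (n : ℂ) + 3) ≠ 0 := by
    intro h
    have := congrArg Complex.re h
    simp at this
    linarith [show (0 : ℝ) ≤ n from Nat.cast_nonneg n]
  have hG : Gammaℝ (2 * n + 3) ≠ 0 := Gammaℝ_ne_zero_of_re_pos (by linarith)
  intro hΛ
  have hζ := riemannZeta_ne_zero_of_one_lt_re hre
  rw [riemannZeta_def_of_ne_zero hne0, hΛ, zero_div] at hζ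
  exact hζ rfl

/-- **A zero `w` of `s(s−1)Λ₀(s)+1` is a non-trivial zero of `ζ`**, with `w ≠ 0`, `w ≠ 1`,
`Γ_ℝ(w) ≠ 0` and `Λ(w) = 0`. [cite: Burnol2001CRAS, §3 (TeX l.522–526, 536–540)] -/
theorem mem_nontrivialZeros_of_xiTwo_eq_zero {w : ℂ}
    (hw : w * (w - 1) * completedRiemannZeta₀ w + 1 = 0) :
    w ∈ ZetaZeros.riemannZetaNontrivialZeros ∧ w ≠ 0 ∧ w ≠ 1 ∧ Gammaℝ w ≠ 0 ∧
      completedRiemannZeta w = 0 := by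
  have hw0 : w ≠ 0 := by rintro rfl; simp at hw
  have hw1 : w ≠ 1 := by rintro rfl; simp at hw
  have hΛ : completedRiemannZeta w = 0 := by
    rw [xiTwo_eq_of_ne hw0 hw1] at hw
    rcases mul_eq_zero.1 hw with h | h
    · rcases mul_eq_zero.1 h with h' | h'
      · exact absurd h' hw0
      · exact absurd (sub_eq_zero.1 h') hw1
    · exact h
  have htriv : ∀ n : ℕ, w ≠ -2 * ((n : ℂ) + 1) := by
    intro n h
    exact completedRiemannZeta_neg_two_mul_ne_zero n (h ▸ hΛ)
  have hG : Gammaℝ w ≠ 0 := by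
    intro h
    obtain ⟨n, hn⟩ := Gammaℝ_eq_zero_iff.1 h
    cases n with
    | zero => exact hw0 (by rw [hn]; simp)
    | succ m => exact htriv m (by rw [hn]; push_cast; ring)
  have hζ : riemannZeta w = 0 := by
    rw [riemannZeta_def_of_ne_zero hw0, hΛ, zero_div]
  refine ⟨⟨hζ, ?_⟩, hw0, hw1, hG, hΛ⟩
  rintro ⟨n, hn⟩
  exact htriv n (by rw [← hn])

/-- `Γ_ℝ` is analytic where it does not vanish (`1/Γ_ℝ` is entire).
[folklore] -/
private theorem analyticAt_Gammaℝ {w : ℂ} (hw : Gammaℝ w ≠ 0) : AnalyticAt ℂ Gammaℝ w := by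
  have h := (differentiable_Gammaℝ_inv.analyticAt w).inv (inv_ne_zero hw)
  have e : (fun s : ℂ ↦ (Gammaℝ s)⁻¹)⁻¹ = Gammaℝ := by funext z; simp
  rwa [e] at h

/-- `Λ` is analytic off `{0, 1}`. [folklore] -/
private theorem analyticAt_completedRiemannZeta {w : ℂ} (hw0 : w ≠ 0) (hw1 : w ≠ 1) :
    AnalyticAt ℂ completedRiemannZeta w := by
  have hopen : IsOpen {z : ℂ | z ≠ 0 ∧ z ≠ 1} :=
    (isOpen_ne.inter isOpen_ne)
  have hdiff : DifferentiableOn ℂ completedRiemannZeta {z : ℂ | z ≠ 0 ∧ z ≠ 1} :=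
    fun z hz ↦ (differentiableAt_completedZeta hz.1 hz.2).differentiableWithinAt
  exact hdiff.analyticAt (hopen.mem_nhds ⟨hw0, hw1⟩)

/-- **`ord_w Λ = ord_w ζ = m_w`** at a point `w ∉ {0, 1}` with `Γ_ℝ(w) ≠ 0`: near `w`,
`Λ = Γ_ℝ · ζ` with `Γ_ℝ` analytic and non-vanishing. [cite: Burnol2001CRAS, §3 (TeX l.522–526)] -/
theorem analyticOrderAt_completedRiemannZeta_eq {w : ℂ} (hw0 : w ≠ 0) (hw1 : w ≠ 1)
    (hG : Gammaℝ w ≠ 0) :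
    analyticOrderAt completedRiemannZeta w = analyticOrderAt riemannZeta w := by
  have hGa : AnalyticAt ℂ Gammaℝ w := analyticAt_Gammaℝ hG
  have hζa : AnalyticAt ℂ riemannZeta w := analyticOn_riemannZeta w hw1
  have hev : completedRiemannZeta =ᶠ[𝓝 w] (Gammaℝ * riemannZeta) := by
    have h1 : ∀ᶠ z in 𝓝 w, z ≠ 0 := isOpen_ne.mem_nhds hw0
    have h2 : ∀ᶠ z in 𝓝 w, Gammaℝ z ≠ 0 := hGa.continuousAt.eventually_ne hG
    filter_upwards [h1, h2] with z hz0 hzG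
    rw [Pi.mul_apply, riemannZeta_def_of_ne_zero hz0, mul_div_cancel₀ _ hzG]
  rw [analyticOrderAt_congr hev, analyticOrderAt_mul hGa hζa, hGa.analyticOrderAt_eq_zero.2 hG, zero_add]

/-- `ord_w (s(s−1)Λ₀+1) = ord_w Λ` for `w ∉ {0,1}`. [cite: Burnol2001CRAS, §3 (TeX l.536–540)] -/
theorem analyticOrderAt_xiTwo_eq {w : ℂ} (hw0 : w ≠ 0) (hw1 : w ≠ 1) :
    analyticOrderAt (fun s : ℂ ↦ s * (s - 1) * completedRiemannZeta₀ s + 1) w =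
      analyticOrderAt completedRiemannZeta w := by
  have hpa : AnalyticAt ℂ (fun s : ℂ ↦ s * (s - 1)) w :=
    (analyticAt_id.mul (analyticAt_id.sub analyticAt_const))
  have hΛa := analyticAt_completedRiemannZeta hw0 hw1
  have hev : (fun s : ℂ ↦ s * (s - 1) * completedRiemannZeta₀ s + 1) =ᶠ[𝓝 w]
      ((fun s : ℂ ↦ s * (s - 1)) * completedRiemannZeta) := by
    have h1 : ∀ᶠ z in 𝓝 w, z ≠ 0 := isOpen_ne.mem_nhds hw0
    have h2 : ∀ᶠ z in 𝓝 w, z ≠ 1 := isOpen_ne.mem_nhds hw1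
    filter_upwards [h1, h2] with z hz0 hz1
    rw [Pi.mul_apply, xiTwo_eq_of_ne hz0 hz1]
  have hp0 : (fun s : ℂ ↦ s * (s - 1)) w ≠ 0 := by
    simp only [ne_eq, mul_eq_zero, not_or]
    exact ⟨hw0, sub_ne_zero.2 hw1⟩
  rw [analyticOrderAt_congr hev, analyticOrderAt_mul hpa hΛa, hpa.analyticOrderAt_eq_zero.2 hp0, zero_add]

/-- `m_w = riemannZetaZeroOrder w` is the analytic order of `ζ` at `w ≠ 1` when that order is finite.
[cite: Burnol2001CRAS, §3 (TeX l.522–526: "`m_ρ` = multiplicité de `ρ`")] -/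
theorem riemannZetaZeroOrder_eq_of_analyticOrderAt {w : ℂ} (hw1 : w ≠ 1) {m : ℕ}
    (hm : analyticOrderAt riemannZeta w = m) : riemannZetaZeroOrder w = m := by
  have ha : AnalyticAt ℂ riemannZeta w := analyticOn_riemannZeta w hw1
  rw [riemannZetaZeroOrder, ha.meromorphicOrderAt_eq, hm]
  rfl

end Xi

section Orders

/-! ### The completed Mellin transform of `E(T_1 T_0 T_wⁿ θ)` and its analytic order at `w` -/

variable {Λ : ℝ} {φ θ : ℝ → ℂ}

/-- `{0,1}ᶜ` is dense in `ℂ`. [folklore] -/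
private theorem dense_ne_zero_ne_one : Dense {s : ℂ | s ≠ 0 ∧ s ≠ 1} := by
  have h : {s : ℂ | s ≠ 0 ∧ s ≠ 1} = ({0}ᶜ : Set ℂ) ∩ {1}ᶜ := by
    ext s; simp
  rw [h]
  exact (dense_compl_singleton 0).inter_of_isOpen_left (dense_compl_singleton 1)
    isOpen_compl_singleton

/-- **Test functions with prescribed Mellin transform `s(s−1)(s−w)ⁿθ̂(s)`**: for `θ ∈ 𝒱_Λ` (`Λ > 0`)
the function `φ = T_1 T_0 T_wⁿ θ` lies in `D(𝒱_Λ)` and `φ̂(s) = s(s−1)(s−w)ⁿθ̂(s)` (the printed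
`φ = Dψ`, `ψ = T_wⁿθ ∈ 𝒱_Λ` "arbitraire"). [cite: Burnol2001CRAS, §3 (TeX l.512–516, 536–540)] -/
theorem exists_memDVLambda_mellin_eq (hΛ : 0 < Λ) (hθ : MemVLambda Λ θ) (w : ℂ) (n : ℕ) :
    ∃ φ : ℝ → ℂ, MemDVLambda Λ φ ∧ ∀ s : ℂ, mellin φ s = s * (s - 1) * ((s - w) ^ n * mellin θ s) := by
  have hψ : MemVLambda Λ ((fun (η : ℝ → ℂ) (t : ℝ) ↦ -((t : ℂ) * deriv η t) - w * η t)^[n] θ) :=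
    hθ.twist_iterate w n
  obtain ⟨hD, hm⟩ := memDVLambda_twist_one_twist_zero hΛ hψ
  refine ⟨_, hD, fun s ↦ ?_⟩
  rw [hm s, hθ.mellin_twist_iterate hΛ w n s]

/-- **`M(E(φ))(s) = (s(s−1)Λ₀(s)+1)·(s−w)ⁿ·θ̂(s)` on all of `ℂ`** whenever `φ̂(s) = s(s−1)(s−w)ⁿθ̂(s)`
(`φ, θ ∈ 𝒱_Λ`, `Λ > 0`): the printed `M(E(Dψ))(s) = ζ(s)s(s−1)π^{−s/2}Γ(s/2)ψ̂(s)` with `ψ = T_wⁿθ`;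
both sides are entire and agree off `{0,1}`. [cite: Burnol2001CRAS, §3 (TeX l.536–540)] -/
theorem completedMellinE_eq_of_mellin_eq (hΛ : 0 < Λ) (hφ : MemVLambda Λ φ) (hθ : MemVLambda Λ θ)
    {w : ℂ} {n : ℕ} (hmel : ∀ s : ℂ, mellin φ s = s * (s - 1) * ((s - w) ^ n * mellin θ s)) :
    (fun s : ℂ ↦ completedRiemannZeta₀ s * mellin φ s - dslope (mellin φ) 0 s + dslope (mellin φ) 1 s) =
      fun s : ℂ ↦ (s * (s - 1) * completedRiemannZeta₀ s + 1) * ((s - w) ^ n * mellin θ s) := by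
  have h0 : mellin φ 0 = 0 := by rw [hmel]; ring
  have h1 : mellin φ 1 = 0 := by rw [hmel]; ring
  refine Continuous.ext_on dense_ne_zero_ne_one (differentiable_completedMellinE hΛ hφ).continuous
    ((differentiable_xiTwo.mul (((differentiable_id.sub_const w).pow n).mul
      (hθ.differentiable_mellin hΛ))).continuous) ?_
  rintro s ⟨hs0, hs1⟩
  simp only
  rw [completedMellinE_eq_of_ne h0 h1 hs0 hs1, hmel s, xiTwo_eq_of_ne hs0 hs1]
  ring

/-- **Order at `w`**: if `φ̂(s) = s(s−1)(s−w)ⁿθ̂(s)` with `θ̂(w) ≠ 0` then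
`ord_w M(E(φ)) = ord_w(s(s−1)Λ₀+1) + n`. [cite: Burnol2001CRAS, §3 (TeX l.536–540)] -/
theorem analyticOrderAt_completedMellinE_eq (hΛ : 0 < Λ) (hφ : MemVLambda Λ φ) (hθ : MemVLambda Λ θ)
    {w : ℂ} {n : ℕ} (hmel : ∀ s : ℂ, mellin φ s = s * (s - 1) * ((s - w) ^ n * mellin θ s))
    (hθw : mellin θ w ≠ 0) :
    analyticOrderAt (fun s : ℂ ↦ completedRiemannZeta₀ s * mellin φ s - dslope (mellin φ) 0 s +
      dslope (mellin φ) 1 s) w =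
      analyticOrderAt (fun s : ℂ ↦ s * (s - 1) * completedRiemannZeta₀ s + 1) w + n := by
  rw [completedMellinE_eq_of_mellin_eq hΛ hφ hθ hmel]
  have hxa : AnalyticAt ℂ (fun s : ℂ ↦ s * (s - 1) * completedRiemannZeta₀ s + 1) w :=
    differentiable_xiTwo.analyticAt w
  have hθa : AnalyticAt ℂ (mellin θ) w := (hθ.differentiable_mellin hΛ).analyticAt w
  have hga : AnalyticAt ℂ (fun s : ℂ ↦ (s - w) ^ n * mellin θ s) w :=
    ((analyticAt_id.sub analyticAt_const).pow n).mul hθa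
  have hg : analyticOrderAt (fun s : ℂ ↦ (s - w) ^ n * mellin θ s) w = n := by
    rw [hga.analyticOrderAt_eq_natCast]
    exact ⟨mellin θ, hθa, hθw, Eventually.of_forall fun z ↦ by simp [smul_eq_mul]⟩
  have e : (fun s : ℂ ↦ (s * (s - 1) * completedRiemannZeta₀ s + 1) * ((s - w) ^ n * mellin θ s)) =
      (fun s : ℂ ↦ s * (s - 1) * completedRiemannZeta₀ s + 1) * fun s : ℂ ↦ (s - w) ^ n * mellin θ s := by
    rfl
  rw [e, analyticOrderAt_mul hxa hga, hg]

/-! ### (⟸): at a non-trivial zero `ρ` with `k < m_ρ`, `M(E(φ))^{(k)}(ρ) = 0` for every `φ ∈ D(𝒱_Λ)` -/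

/-- A non-trivial zero `ρ` of `ζ` satisfies `ζ(ρ) = 0`, `ρ ≠ 0`, `ρ ≠ 1`, `Γ_ℝ(ρ) ≠ 0`.
[cite: Burnol2001CRAS, §3 (TeX l.522–526)] -/
theorem nontrivialZeros_aux {ρ : ℂ} (hρ : ρ ∈ ZetaZeros.riemannZetaNontrivialZeros) :
    riemannZeta ρ = 0 ∧ ρ ≠ 0 ∧ ρ ≠ 1 ∧ Gammaℝ ρ ≠ 0 := by
  obtain ⟨hz, hnt⟩ := hρ
  have hζ : riemannZeta ρ = 0 := hz
  have h0 : ρ ≠ 0 := by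
    rintro rfl
    rw [riemannZeta_zero] at hζ
    norm_num at hζ
  have h1 : ρ ≠ 1 := by
    rintro rfl
    exact riemannZeta_one_ne_zero hζ
  refine ⟨hζ, h0, h1, fun hG ↦ ?_⟩
  obtain ⟨n, hn⟩ := Gammaℝ_eq_zero_iff.1 hG
  cases n with
  | zero => exact h0 (by rw [hn]; simp)
  | succ m =>
    apply hnt
    exact ⟨m, by rw [hn]; push_cast; ring⟩

/-- **(⟸) of Théorème 3.1, analytic core**: for `φ ∈ D(𝒱_Λ)` (`Λ > 0`), a non-trivial zero `ρ` and
`k < m_ρ`, the `k`-th derivative of `M(E(φ))` vanishes at `ρ` (`M(E(φ)) = Γ_ℝ·ζ·φ̂` near `ρ` has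
order `≥ m_ρ > k`). [cite: Burnol2001CRAS, Théorème 3.1 (TeX l.522–526, 536–540)] -/
theorem iteratedDeriv_completedMellinE_eq_zero (hΛ : 0 < Λ) (hφ : MemDVLambda Λ φ) {ρ : ℂ} {k : ℕ}
    (hρ : ρ ∈ ZetaZeros.riemannZetaNontrivialZeros) (hk : (k : ℤ) < riemannZetaZeroOrder ρ) :
    iteratedDeriv k (fun s : ℂ ↦ completedRiemannZeta₀ s * mellin φ s - dslope (mellin φ) 0 s +
      dslope (mellin φ) 1 s) ρ = 0 := by
  obtain ⟨hV, h0, h1⟩ := memDVLambda_iff_mellin.1 hφ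
  obtain ⟨_, hρ0, hρ1, hG⟩ := nontrivialZeros_aux hρ
  have hζa : AnalyticAt ℂ riemannZeta ρ := analyticOn_riemannZeta ρ hρ1
  -- the analytic order of `ζ` at `ρ` is a natural number `m > k`
  obtain ⟨m, hm⟩ : ∃ m : ℕ, analyticOrderAt riemannZeta ρ = m := by
    have hne : analyticOrderAt riemannZeta ρ ≠ ⊤ := by
      intro htop
      have : riemannZetaZeroOrder ρ = 0 := by
        rw [riemannZetaZeroOrder, hζa.meromorphicOrderAt_eq, htop]
        rfl
      rw [this] at hk
      exact absurd hk (by exact_mod_cast Nat.not_lt_zero k)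
    obtain ⟨m, hm⟩ := ENat.ne_top_iff_exists.1 hne
    exact ⟨m, hm.symm⟩
  have hkm : k + 1 ≤ m := by
    rw [riemannZetaZeroOrder_eq_of_analyticOrderAt hρ1 hm] at hk
    omega
  -- `M(E(φ)) = Λ · φ̂` near `ρ`
  have hΛa := analyticAt_completedRiemannZeta hρ0 hρ1
  have hφa : AnalyticAt ℂ (mellin φ) ρ := (hV.differentiable_mellin hΛ).analyticAt ρ
  have hMa : AnalyticAt ℂ (fun s : ℂ ↦ completedRiemannZeta₀ s * mellin φ s - dslope (mellin φ) 0 s +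
      dslope (mellin φ) 1 s) ρ := (differentiable_completedMellinE hΛ hV).analyticAt ρ
  have hev : (fun s : ℂ ↦ completedRiemannZeta₀ s * mellin φ s - dslope (mellin φ) 0 s +
      dslope (mellin φ) 1 s) =ᶠ[𝓝 ρ] (completedRiemannZeta * mellin φ) := by
    have e1 : ∀ᶠ z in 𝓝 ρ, z ≠ 0 := isOpen_ne.mem_nhds hρ0
    have e2 : ∀ᶠ z in 𝓝 ρ, z ≠ 1 := isOpen_ne.mem_nhds hρ1
    filter_upwards [e1, e2] with z hz0 hz1
    rw [Pi.mul_apply, completedMellinE_eq_of_ne h0 h1 hz0 hz1]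
  have hord : ((k + 1 : ℕ) : ℕ∞) ≤ analyticOrderAt (fun s : ℂ ↦ completedRiemannZeta₀ s * mellin φ s -
      dslope (mellin φ) 0 s + dslope (mellin φ) 1 s) ρ := by
    rw [analyticOrderAt_congr hev, analyticOrderAt_mul hΛa hφa,
      analyticOrderAt_completedRiemannZeta_eq hρ0 hρ1 hG, hm]
    calc ((k + 1 : ℕ) : ℕ∞) ≤ (m : ℕ∞) := by exact_mod_cast hkm
      _ ≤ (m : ℕ∞) + analyticOrderAt (mellin φ) ρ := le_self_add
  exact (natCast_le_analyticOrderAt_iff_iteratedDeriv_eq_zero hMa).1 hord k (Nat.lt_succ_self k)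

/-! ### (⟹): if `M(E(φ))^{(k)}(w) = 0` for all `φ ∈ D(𝒱_Λ)`, then `w = ρ` and `k < m_ρ` -/

/-- **(⟹) of Théorème 3.1, analytic core** (`Λ > 1`): if the `k`-th derivative at `w` of `M(E(φ))`
vanishes for every `φ ∈ D(𝒱_Λ)`, then `w` is a non-trivial zero of `ζ` and `k < m_w`. Proof: let
`m = ord_w(s(s−1)Λ₀+1)`; if `m ≤ k`, the test function `φ = T_1T_0T_w^{k−m}θ` with `θ̂(w) ≠ 0` gives
`ord_w M(E(φ)) = k`, so the `k`-th derivative is non-zero — contradiction; hence `m > k ≥ 0`, `w` is a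
zero of `s(s−1)Λ(s)`, i.e. a non-trivial zero, and `m_w = m > k` ("puisque `ψ ∈ 𝒱_Λ` est arbitraire").
[cite: Burnol2001CRAS, Théorème 3.1 (TeX l.522–526, 536–540)] -/
theorem mem_nontrivialZeros_of_forall_iteratedDeriv_eq_zero (hΛ : 1 < Λ) {w : ℂ} {k : ℕ}
    (h : ∀ φ : ℝ → ℂ, MemDVLambda Λ φ →
      iteratedDeriv k (fun s : ℂ ↦ completedRiemannZeta₀ s * mellin φ s - dslope (mellin φ) 0 s +
        dslope (mellin φ) 1 s) w = 0) :
    w ∈ ZetaZeros.riemannZetaNontrivialZeros ∧ (k : ℤ) < riemannZetaZeroOrder w := by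
  have hΛ0 : 0 < Λ := zero_lt_one.trans hΛ
  obtain ⟨m, hm⟩ := ENat.ne_top_iff_exists.1 (analyticOrderAt_xiTwo_ne_top w)
  have hm' := hm.symm
  obtain ⟨θ, hθ, hθw⟩ := exists_memVLambda_mellin_ne_zero hΛ w
  by_cases hmk : m ≤ k
  · -- the test function `T_1 T_0 T_w^{k-m} θ` has `ord_w M = k`, contradiction
    exfalso
    obtain ⟨φ, hφD, hmel⟩ := exists_memDVLambda_mellin_eq hΛ0 hθ w (k - m)
    have hord := analyticOrderAt_completedMellinE_eq hΛ0 hφD.1 hθ hmel hθw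
    rw [hm'] at hord
    have hk : analyticOrderAt (fun s : ℂ ↦ completedRiemannZeta₀ s * mellin φ s - dslope (mellin φ) 0 s +
        dslope (mellin φ) 1 s) w = (k : ℕ) := by
      rw [hord]
      norm_cast
      omega
    have hMa : AnalyticAt ℂ (fun s : ℂ ↦ completedRiemannZeta₀ s * mellin φ s - dslope (mellin φ) 0 s +
        dslope (mellin φ) 1 s) w := (differentiable_completedMellinE hΛ0 hφD.1).analyticAt w
    exact ((analyticOrderAt_eq_nat_iff_iteratedDeriv_eq_zero hMa).1 hk).2 (h φ hφD)
  · -- `m ≥ k+1 ≥ 1`: `w` is a zero of `s(s-1)Λ₀+1`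
    push Not at hmk
    have hne : analyticOrderAt (fun s : ℂ ↦ s * (s - 1) * completedRiemannZeta₀ s + 1) w ≠ 0 := by
      rw [hm']
      exact_mod_cast (show m ≠ 0 by omega)
    have hzero := apply_eq_zero_of_analyticOrderAt_ne_zero hne
    obtain ⟨hmem, hw0, hw1, hG, -⟩ := mem_nontrivialZeros_of_xiTwo_eq_zero hzero
    refine ⟨hmem, ?_⟩
    have hordζ : analyticOrderAt riemannZeta w = m := by
      rw [← analyticOrderAt_completedRiemannZeta_eq hw0 hw1 hG, ← analyticOrderAt_xiTwo_eq hw0 hw1, hm']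
    rw [riemannZetaZeroOrder_eq_of_analyticOrderAt hw1 hordζ]
    exact_mod_cast hmk

end Orders

section Assembly

/-! ### `⟪E(φ), Z^Λ_{w,k}⟫ = 2 M(E(φ̄))^{(k)}(w)` and the discharge -/

variable {Λ : ℝ} {φ : ℝ → ℂ}

/-- `D(𝒱_Λ)` is stable under complex conjugation. [cite: Burnol2001CRAS, §3 (TeX l.503–516)] -/
theorem MemDVLambda.conj (hφ : MemDVLambda Λ φ) : MemDVLambda Λ (fun t : ℝ ↦ conj (φ t)) := by
  obtain ⟨⟨hs, hsupp⟩, h0, h1⟩ := hφ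
  refine ⟨⟨Complex.conjCLE.contDiff.comp hs, ?_⟩, ?_, ?_⟩
  · intro t ht
    apply hsupp
    rw [Function.mem_support] at ht ⊢
    intro h
    exact ht (by rw [h, map_zero])
  · have : (fun t : ℝ ↦ conj (φ t) / (t : ℂ)) = fun t : ℝ ↦ conj (φ t / (t : ℂ)) := by
      funext t
      rw [map_div₀, Complex.conj_ofReal]
    rw [this, integral_conj, h0, map_zero]
  · rw [integral_conj, h1, map_zero]

/-- `\overline{E(φ)} = E(φ̄)` pointwise. [cite: Burnol2001CRAS, §3 (TeX l.509–511)] -/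
theorem conj_poissonE (φ : ℝ → ℂ) (u : ℝ) :
    conj (poissonE φ u) = poissonE (fun t : ℝ ↦ conj (φ t)) u := by
  rw [poissonE, poissonE, map_sub, Complex.conj_tsum, map_div₀, Complex.conj_ofReal, ← integral_conj]

/-- For an integrable, a.e.-even `G : ℝ → ℂ`: `∫_ℝ G = 2 ∫₀^∞ G`. [folklore] -/
private theorem integral_eq_two_mul_setIntegral_Ioi {G : ℝ → ℂ} (hG : Integrable G)
    (heven : ∀ᵐ x : ℝ, G (-x) = G x) : ∫ x, G x = 2 * ∫ x in Ioi (0 : ℝ), G x := by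
  have h1 : ∫ x in Iic (0 : ℝ), G x = ∫ x in Ioi (0 : ℝ), G x := by
    have h2 : ∫ x in Iic (0 : ℝ), G (-x) = ∫ x in Ioi (-0 : ℝ), G x := integral_comp_neg_Iic 0 G
    rw [neg_zero] at h2
    rw [← h2]
    refine setIntegral_congr_ae measurableSet_Iic ?_
    filter_upwards [heven] with x hx _
    exact hx.symm
  have h3 := intervalIntegral.integral_Iic_add_Ioi (μ := volume) (f := G) (b := 0)
    hG.integrableOn hG.integrableOn
  rw [← h3, h1]
  ring

/-- **`⟪F, Z⟫ = 2 · M(E(φ̄))^{(k)}(w)`** for the `L²` class `F` of `E(φ)` (`φ ∈ D(𝒱_Λ)`, `Λ > 0`) and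
an evaluator `Z = Z^Λ_{w,k}` (`IsEvaluatorZ`): Mathlib's inner product is `∫_ℝ \bar F Z = 2∫₀^∞ E(φ̄) Z`
(both classes are even), and `E(φ̄) ∈ H_Λ` has completed Mellin transform `M(E(φ̄))`, so the defining
property of the evaluator applies ("`∀ f ∈ H_Λ, M(f)^{(k)}(w) = (f, Z^Λ_{w,k}]`", TeX l.463–466).
[cite: Burnol2001CRAS, Prop. 2.2 and Thm. 3.1 (TeX l.463–466, 522–540)] -/
theorem inner_eq_two_mul_iteratedDeriv (hΛ : 0 < Λ) (hφ : MemDVLambda Λ φ)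
    {F Z : Lp ℂ 2 (volume : Measure ℝ)} (hF : ∀ᵐ u : ℝ, F u = poissonE φ u) {w : ℂ} {k : ℕ}
    (hZ : IsEvaluatorZ Λ w k Z) :
    inner ℂ F Z = 2 * iteratedDeriv k (fun s : ℂ ↦ completedRiemannZeta₀ s *
      mellin (fun t : ℝ ↦ conj (φ t)) s - dslope (mellin (fun t : ℝ ↦ conj (φ t))) 0 s +
      dslope (mellin (fun t : ℝ ↦ conj (φ t))) 1 s) w := by
  have hψ : MemDVLambda Λ (fun t : ℝ ↦ conj (φ t)) := hφ.conj
  obtain ⟨F', hF', hF'mem⟩ := exists_memHLambda_ae_eq_poissonE hΛ hψ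
  have hM : IsCompletedMellin (F' : ℝ → ℂ) (fun s : ℂ ↦ completedRiemannZeta₀ s *
      mellin (fun t : ℝ ↦ conj (φ t)) s - dslope (mellin (fun t : ℝ ↦ conj (φ t))) 0 s +
      dslope (mellin (fun t : ℝ ↦ conj (φ t))) 1 s) :=
    (isCompletedMellin_poissonE hΛ hψ).congr_ae hF'
  have hev := hZ.2 F' hF'mem _ hM
  -- the inner product as an integral of `\bar F · Z = F' · Z`
  have hint : Integrable (fun t : ℝ ↦ inner ℂ ((F : ℝ → ℂ) t) ((Z : ℝ → ℂ) t)) :=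
    L2.integrable_inner F Z
  have hae : (fun t : ℝ ↦ inner ℂ ((F : ℝ → ℂ) t) ((Z : ℝ → ℂ) t)) =ᵐ[volume]
      fun t : ℝ ↦ (F' : ℝ → ℂ) t * (Z : ℝ → ℂ) t := by
    filter_upwards [hF, hF'] with t h1 h2
    rw [RCLike.inner_apply, h1, h2, conj_poissonE, mul_comm]
  have hint' : Integrable (fun t : ℝ ↦ (F' : ℝ → ℂ) t * (Z : ℝ → ℂ) t) := hint.congr hae
  have heven : ∀ᵐ x : ℝ, (F' : ℝ → ℂ) (-x) * (Z : ℝ → ℂ) (-x) = (F' : ℝ → ℂ) x * (Z : ℝ → ℂ) x := by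
    have h1 : ∀ᵐ x : ℝ, (F' : ℝ → ℂ) (-x) = (F' : ℝ → ℂ) x := hF'mem.1
    have h2 : ∀ᵐ x : ℝ, (Z : ℝ → ℂ) (-x) = (Z : ℝ → ℂ) x := hZ.1.1
    filter_upwards [h1, h2] with x hx1 hx2
    rw [hx1, hx2]
  rw [L2.inner_def, integral_congr_ae hae, integral_eq_two_mul_setIntegral_Ioi hint' heven, hev]

/-- **Burnol 2001 (CRAS 333), Théorème 3.1 — PROVED** (discharge of the named fact
`Burnol2001CRAS_thm3_1`): for `Λ > 1`, `W_Λ ⊂ H_Λ`, and an evaluator `Z^Λ_{w,k}` is perpendicular to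
`W_Λ` iff `w` is a non-trivial zero `ρ` of `ζ` and `k < m_ρ`. Proof as printed: `E(φ) ∈ H_Λ` by the
co-Poisson formula (`crasW_subset_memHLambda`); `⟪E(φ), Z⟫ = 2M(E(φ̄))^{(k)}(w)` with
`M(E(φ)) = Λ(s)φ̂(s)` entire (Müntz); (⟸) `Λφ̂` vanishes to order `≥ m_ρ > k` at `ρ`; (⟹) the jets of
`ψ̂`, `ψ ∈ 𝒱_Λ` arbitrary, detect the order of `s(s−1)Λ(s)` at `w`.
[cite: Burnol2001CRAS, Théorème 3.1 (TeX l.522–540)] -/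
theorem Burnol2001CRAS_thm3_1_holds : Burnol2001CRAS_thm3_1 := by
  intro Λ hΛ
  have hΛ0 : 0 < Λ := zero_lt_one.trans hΛ
  refine ⟨crasW_subset_memHLambda hΛ0, fun w k Z hZ ↦ ⟨fun hperp ↦ ?_, fun hρ ↦ ?_⟩⟩
  · -- (⟹): every `M(E(φ))^{(k)}(w)` vanishes, `φ ∈ D(𝒱_Λ)`
    refine mem_nontrivialZeros_of_forall_iteratedDeriv_eq_zero hΛ fun φ hφ ↦ ?_
    have hψ : MemDVLambda Λ (fun t : ℝ ↦ conj (φ t)) := hφ.conj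
    obtain ⟨F, hF, -⟩ := exists_memHLambda_ae_eq_poissonE hΛ0 hψ
    have hFW : F ∈ crasW Λ := subset_closure ⟨_, hψ, hF⟩
    have h := inner_eq_two_mul_iteratedDeriv hΛ0 hψ hF hZ
    rw [hperp F hFW] at h
    simp only [Complex.conj_conj] at h
    have h2 : (2 : ℂ) ≠ 0 := two_ne_zero
    exact (mul_eq_zero.1 h.symm).resolve_left h2
  · -- (⟸): at a non-trivial zero `ρ` with `k < m_ρ`
    obtain ⟨hρ, hk⟩ := hρ
    have hclosed : IsClosed {F : Lp ℂ 2 (volume : Measure ℝ) | inner ℂ F Z = 0} :=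
      isClosed_eq (continuous_id.inner continuous_const) continuous_const
    refine hclosed.closure_subset_iff.2 ?_
    rintro G ⟨φ, hφ, hG⟩
    show inner ℂ G Z = 0
    rw [inner_eq_two_mul_iteratedDeriv hΛ0 hφ hG hZ,
      iteratedDeriv_completedMellinE_eq_zero hΛ0 hφ.conj hρ hk, mul_zero]

end Assembly

end Burnol2001

end Literature.Analysis.DeBrangesSpaces
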